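import Literature.AlgebraicGeometry.HodgeTheory.WeilClassesSquareKSymmetric
import HarnessLib

/-!
# The mixed classes of a PRODUCT polarization: `ω(Σ_t π_t^*o_t) = Σ_t (π_t × π_t)^* ω(o_t)` (the block dictionary `P1_t`, `Ps_t`)

Family `hodge`, layer `Literature/AlgebraicGeometry/HodgeTheory`. Bookkeeping sequel of `WeilClassesSquareKSymmetric`: the two mixed classes
`ω = sqMixedClass T θ` and `ω_φ = sqGraphMixedClass φ θ` of the twisted square `T × T` are LINEAR in `θ` and NATURAL in `T`, so for a
class pulled back from a factor, `θ = π^*o` along a homomorphism `π : T ⟶ E` (intertwining `φ` on `T` with `ψ` on `E` for the graph class),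
they are pulled back from the square of the factor along `π × π : T × T ⟶ E × E`:

* `sqMixedClass_map`: `ω_T(π^*o) = (π × π)^* ω_E(o)`;  `sqGraphMixedClass_map`: `ω_{φ,T}(π^*o) = (π × π)^* ω_{ψ,E}(o)` if `π ≫ ψ = φ ≫ π`;
* `sqMixedClass_sum`, `sqGraphMixedClass_sum`: additivity over a finite sum of such classes.

Hence for the B2b ladder's CM anchor `T = E_K³`, `θ = Σ_t π_t^*[o]` (product principal polarization), `φ = (√-d)^{×3}`:
`ω = Σ_t (π_t × π_t)^* ω_E([o])` and `ω_φ = Σ_t (π_t × π_t)^* ω_{√-d,E}([o])` with `ω_E([o]) = m^*[o] - [o × E] - [E × o]` and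
`ω_{√-d,E}([o]) = (pr₁ + pr₂ ≫ √-d)^*[o] - [o × E] - (pr₂ ≫ √-d)^*[o]` the two mixed classes of the elliptic curve — the packet's `P1_t` and `Ps_t`
(`LADDER.md` C36, C50) up to the orientation conventions of the graphs. Pure bookkeeping (linearity + `f^*g^* = (f ≫ g)^*`); no named fact;
no definition; not a rung.

## References

* [LangeBirkenhake1992] H. Lange, Ch. Birkenhake, Complex Abelian Varieties (1992), 1.1.2, Lemma 1.1.17, §5.
* [Deligne1982HodgeCycles] P. Deligne, LNM 900 (1982), §4 Remark 4.10.
-/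

noncomputable section

open CategoryTheory

namespace Literature.AlgebraicGeometry.HodgeTheory

open Literature.AlgebraicTopology.SingularHomology
open Literature.AlgebraicGeometry.Motives

section HodgeTheory

variable {T E : Motives.AbelianVariety ℂ}

/-- The product map `π × π : T × T ⟶ E × E` intertwines the projections and the sum map:
`(π × π) ≫ pr₁ = p₁ ≫ π`, `(π × π) ≫ pr₂ = p₂ ≫ π`. [folklore] -/
theorem prodMap_comp_proj (π : T ⟶ E) :
    AbelianVariety.prodLift (AbelianVariety.fst T T ≫ π) (AbelianVariety.snd T T ≫ π) ≫ AbelianVariety.fst E E =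
        AbelianVariety.fst T T ≫ π ∧
      AbelianVariety.prodLift (AbelianVariety.fst T T ≫ π) (AbelianVariety.snd T T ≫ π) ≫ AbelianVariety.snd E E =
        AbelianVariety.snd T T ≫ π :=
  ⟨AbelianVariety.prodLift_fst _ _, AbelianVariety.prodLift_snd _ _⟩

/-- **Naturality of the mixed class: `ω_T(π^*o) = (π × π)^* ω_E(o)`** for `π : T ⟶ E` and `o ∈ H²(E(ℂ); ℂ)`.
[cite: LangeBirkenhake1992, 1.1.2 and Lemma 1.1.17] -/
theorem sqMixedClass_map (π : T ⟶ E) (o : complexBetti E.X 2) :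
    sqMixedClass T (complexBetti.map π.hom.hom.hom 2 o) =
      complexBetti.map (AbelianVariety.prodLift (AbelianVariety.fst T T ≫ π) (AbelianVariety.snd T T ≫ π)).hom.hom.hom 2
        (sqMixedClass E o) := by
  obtain ⟨h1, h2⟩ := prodMap_comp_proj π
  rw [sqMixedClass, sqMixedClass, map_sub, map_sub, complexBetti_map_map_hom, complexBetti_map_map_hom, complexBetti_map_map_hom,
    complexBetti_map_map_hom, complexBetti_map_map_hom, complexBetti_map_map_hom, Preadditive.comp_add, h1, h2, Preadditive.add_comp]

/-- **Naturality of the graph mixed class: `ω_{φ,T}(π^*o) = (π × π)^* ω_{ψ,E}(o)`** when `π ≫ ψ = φ ≫ π` (`π` intertwines the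
`K`-actions). [cite: LangeBirkenhake1992, 1.1.2 and Lemma 1.1.17] -/
theorem sqGraphMixedClass_map (π : T ⟶ E) {φ : T ⟶ T} {ψ : E ⟶ E} (hπ : π ≫ ψ = φ ≫ π) (o : complexBetti E.X 2) :
    sqGraphMixedClass φ (complexBetti.map π.hom.hom.hom 2 o) =
      complexBetti.map (AbelianVariety.prodLift (AbelianVariety.fst T T ≫ π) (AbelianVariety.snd T T ≫ π)).hom.hom.hom 2
        (sqGraphMixedClass ψ o) := by
  obtain ⟨h1, h2⟩ := prodMap_comp_proj π
  rw [sqGraphMixedClass, sqGraphMixedClass, map_sub, map_sub, complexBetti_map_map_hom, complexBetti_map_map_hom,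
    complexBetti_map_map_hom, complexBetti_map_map_hom, complexBetti_map_map_hom, complexBetti_map_map_hom, Preadditive.comp_add, h1,
    ← Category.assoc, h2, Category.assoc, Category.assoc, hπ, Preadditive.add_comp, Category.assoc]

/-- The mixed class is additive: `ω(Σ_t θ_t) = Σ_t ω(θ_t)`. [folklore] -/
theorem sqMixedClass_sum {ι : Type*} (s : Finset ι) (θ : ι → complexBetti T.X 2) :
    sqMixedClass T (∑ t ∈ s, θ t) = ∑ t ∈ s, sqMixedClass T (θ t) := by
  simp only [sqMixedClass, map_sum, Finset.sum_sub_distrib]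

/-- The graph mixed class is additive: `ω_φ(Σ_t θ_t) = Σ_t ω_φ(θ_t)`. [folklore] -/
theorem sqGraphMixedClass_sum {ι : Type*} (s : Finset ι) (φ : T ⟶ T) (θ : ι → complexBetti T.X 2) :
    sqGraphMixedClass φ (∑ t ∈ s, θ t) = ∑ t ∈ s, sqGraphMixedClass φ (θ t) := by
  simp only [sqGraphMixedClass, map_sum, Finset.sum_sub_distrib]

/-- **The block dictionary.** For a product-type class `θ = Σ_t π_t^* o_t` (`π_t : T ⟶ E_t`... here all factors equal `E`) on `T`:
`ω_T(θ) = Σ_t (π_t × π_t)^* ω_E(o_t)` — at the CM anchor `T = E_K³`, `o_t = [o]`, these summands are the packet's `P1_t`.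
[cite: LangeBirkenhake1992, §5] -/
theorem sqMixedClass_sum_map {ι : Type*} (s : Finset ι) (π : ι → (T ⟶ E)) (o : ι → complexBetti E.X 2) :
    sqMixedClass T (∑ t ∈ s, complexBetti.map (π t).hom.hom.hom 2 (o t)) =
      ∑ t ∈ s, complexBetti.map (AbelianVariety.prodLift (AbelianVariety.fst T T ≫ π t) (AbelianVariety.snd T T ≫ π t)).hom.hom.hom 2
        (sqMixedClass E (o t)) := by
  rw [sqMixedClass_sum]
  exact Finset.sum_congr rfl fun t _ => sqMixedClass_map (π t) (o t)

/-- **The block dictionary for the graph class.** If every `π_t` intertwines (`π_t ≫ ψ = φ ≫ π_t`), then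
`ω_{φ,T}(Σ_t π_t^* o_t) = Σ_t (π_t × π_t)^* ω_{ψ,E}(o_t)` — at the CM anchor these summands are the packet's `Ps_t`. [cite: LangeBirkenhake1992, §5] -/
theorem sqGraphMixedClass_sum_map {ι : Type*} (s : Finset ι) (π : ι → (T ⟶ E)) {φ : T ⟶ T} {ψ : E ⟶ E}
    (hπ : ∀ t, π t ≫ ψ = φ ≫ π t) (o : ι → complexBetti E.X 2) :
    sqGraphMixedClass φ (∑ t ∈ s, complexBetti.map (π t).hom.hom.hom 2 (o t)) =
      ∑ t ∈ s, complexBetti.map (AbelianVariety.prodLift (AbelianVariety.fst T T ≫ π t) (AbelianVariety.snd T T ≫ π t)).hom.hom.hom 2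
        (sqGraphMixedClass ψ (o t)) := by
  rw [sqGraphMixedClass_sum]
  exact Finset.sum_congr rfl fun t _ => sqGraphMixedClass_map (π t) (hπ t) (o t)

end HodgeTheory

end Literature.AlgebraicGeometry.HodgeTheory

end
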